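import Summits.KontsevichZagierPeriods.KontsevichZagierPeriods.Theses.SymplecticScissors
import Literature.NumberTheory.Transcendental.AyoubPeriodSeries
import Literature.NumberTheory.Transcendental.AyoubPeriodSeriesKernel
import Literature.NumberTheory.Transcendental.AyoubPeriodSeriesPiAlgebraic
import Summits.KontsevichZagierPeriods.KontsevichZagierPeriods.Theorems.UnfoldedStokesStokesGenerationStubSpanToRepsAuxCoeff
import Mathlib.RingTheory.MvPowerSeries.Rename
import Mathlib.RingTheory.MvPowerSeries.Substitution
import Summits.KontsevichZagierPeriods.KontsevichZagierPeriods.Theorems.SymplecticScissorsTypeAGenerationStubRoomStepCongruence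

/-!
# `TypeAGeneration` (stmt-KontsevichZagierPeriods-18392), line `Sketch`, stub `stub_pdzCalculus` (W1)

The formal partial derivative `∂/∂zᵢ` (`AyoubRel.pdz i`,
`coeff_a (∂ᵢ F) = (aᵢ + 1) coeff_{a + eᵢ} F`) of `ℂ[[z₀, z₁, …]]`
(`AyoubRel.CSeries = MvPowerSeries ℕ ℂ`) is a `ℂ`-linear derivation commuting with the other
partials, with `∂ᵢ z_l = [l = i]` and `∂ᵢ c = 0` on constants.

The Leibniz rule is proved through the Euler form `zᵢ ∂ᵢ`: `coeff_a (zᵢ ∂ᵢ F) = aᵢ coeff_a F`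
(`w1_coeff_X_mul_pdz`), so that on the Cauchy product over `antidiagonal (a + eᵢ)` the weight
`aᵢ + 1 = bᵢ + b'ᵢ` splits each term into the two Leibniz terms without any reindexing; the factor
`zᵢ` is then cancelled (`s2_coeff_X_mul_add_single`). Helper names carry the prefix `w1`.
Elementary coefficient bookkeeping (folklore); no definition is introduced.
-/

noncomputable section

-- `Summit.KontsevichZagierPeriods.KontsevichZagierPeriods.…` is the tree's mandated layout (single-conjunct summit).
set_option linter.dupNamespace false

namespace Summit.KontsevichZagierPeriods.KontsevichZagierPeriods.TypeAGenerationLine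

open Finsupp MvPowerSeries
open Literature.NumberTheory.Transcendental
open Literature.NumberTheory.Transcendental.AyoubRel
open Summit.KontsevichZagierPeriods.KontsevichZagierPeriods.Theses.SymplecticScissors (TypeAGeneration)

/-! ## Linearity -/

/-- `ℂ`-linearity of `∂ᵢ`: `∂ᵢ (c F + G) = c ∂ᵢ F + ∂ᵢ G`. [folklore] -/
theorem w1_pdz_smul_add (i : ℕ) (F G : CSeries) (c : ℂ) :
    pdz i (c • F + G) = c • pdz i F + pdz i G := by
  refine MvPowerSeries.ext fun a => ?_
  rw [map_add, coeff_smul, StokesGenerationLine.coeff_pdz, StokesGenerationLine.coeff_pdz,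
    StokesGenerationLine.coeff_pdz, map_add, coeff_smul]
  ring

/-! ## The Euler form `zᵢ ∂ᵢ` and the Leibniz rule -/

/-- The Euler form of `∂ᵢ`: `coeff_a (zᵢ ∂ᵢ F) = aᵢ coeff_a F`. [folklore] -/
theorem w1_coeff_X_mul_pdz (i : ℕ) (F : CSeries) (a : ℕ →₀ ℕ) :
    coeff a (X i * pdz i F) = (a i : ℂ) * coeff a F := by
  rw [X_def, coeff_monomial_mul]
  split_ifs with h
  · have h1 : 1 ≤ a i := Finsupp.single_le_iff.mp h
    rw [one_mul, StokesGenerationLine.coeff_pdz, tsub_add_cancel_of_le h, Finsupp.tsub_apply,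
      single_eq_same, Nat.cast_sub h1, Nat.cast_one, sub_add_cancel]
  · rw [Finsupp.single_le_iff, not_le, Nat.lt_one_iff] at h
    rw [h, Nat.cast_zero, zero_mul]

/-- **Leibniz rule**: `∂ᵢ (F G) = ∂ᵢ F · G + F · ∂ᵢ G`. [folklore] -/
theorem w1_pdz_mul (i : ℕ) (F G : CSeries) :
    pdz i (F * G) = pdz i F * G + F * pdz i G := by
  refine MvPowerSeries.ext fun a => ?_
  rw [← s2_coeff_X_mul_add_single i (pdz i F * G + F * pdz i G) a, mul_add, ← mul_assoc,
    mul_left_comm, map_add, StokesGenerationLine.coeff_pdz, coeff_mul _ F G,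
    coeff_mul _ (X i * pdz i F) G, coeff_mul _ F (X i * pdz i G), Finset.mul_sum,
    ← Finset.sum_add_distrib]
  refine Finset.sum_congr rfl fun p hp => ?_
  rw [Finset.HasAntidiagonal.mem_antidiagonal] at hp
  have h : (a i : ℂ) + 1 = (p.1 i : ℂ) + (p.2 i : ℂ) := by
    have h' := DFunLike.congr_fun hp i
    rw [Finsupp.add_apply, Finsupp.add_apply, single_eq_same] at h'
    exact_mod_cast h'.symm
  rw [w1_coeff_X_mul_pdz, w1_coeff_X_mul_pdz, h]
  ring

/-! ## Commuting partials; variables; constants -/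

/-- The partials commute: `∂ᵢ ∂ⱼ = ∂ⱼ ∂ᵢ`. [folklore] -/
theorem w1_pdz_comm (i j : ℕ) (F : CSeries) : pdz i (pdz j F) = pdz j (pdz i F) := by
  refine MvPowerSeries.ext fun a => ?_
  rw [StokesGenerationLine.coeff_pdz, StokesGenerationLine.coeff_pdz,
    StokesGenerationLine.coeff_pdz, StokesGenerationLine.coeff_pdz, Finsupp.add_apply,
    Finsupp.add_apply, single_apply, single_apply, add_right_comm a (single i 1) (single j 1)]
  rcases eq_or_ne i j with rfl | hij
  · rfl
  · rw [if_neg hij, if_neg hij.symm]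
    push_cast
    ring

/-- `∂ᵢ z_l = [l = i]`. [folklore] -/
theorem w1_pdz_X (i l : ℕ) : pdz i (X l : CSeries) = if l = i then 1 else 0 := by
  rcases eq_or_ne l i with rfl | hl
  · rw [if_pos rfl]
    refine MvPowerSeries.ext fun a => ?_
    rw [StokesGenerationLine.coeff_pdz, coeff_X, coeff_one]
    by_cases ha : a = 0
    · subst ha
      simp
    · rw [if_neg ha, if_neg fun h => ha (add_eq_right.mp h), mul_zero]
  · rw [if_neg hl]
    refine MvPowerSeries.ext fun a => ?_
    rw [StokesGenerationLine.coeff_pdz, coeff_X, coeff_zero, if_neg, mul_zero]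
    intro h
    have h' := DFunLike.congr_fun h i
    rw [Finsupp.add_apply, single_eq_same, single_apply, if_neg hl] at h'
    omega

/-- `∂ᵢ c = 0` on constants. [folklore] -/
theorem w1_pdz_C (i : ℕ) (c : ℂ) : pdz i (C c : CSeries) = 0 := by
  refine MvPowerSeries.ext fun a => ?_
  rw [StokesGenerationLine.coeff_pdz, coeff_add_single_C, mul_zero, coeff_zero]

/-! ## Registered stub -/

/-- W1 — `∂/∂zᵢ` is a `ℂ`-linear derivation of `ℂ[[z]]` commuting with the other partials, with
`∂ᵢ z_l = [l = i]` and `∂ᵢ c = 0`. [folklore] -/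
theorem stub_pdzCalculus :
    ∀ (i : ℕ) (F G : CSeries) (c : ℂ),
      pdz i (c • F + G) = c • pdz i F + pdz i G ∧
      pdz i (F * G) = pdz i F * G + F * pdz i G ∧
      (∀ j : ℕ, pdz i (pdz j F) = pdz j (pdz i F)) ∧
      (∀ l : ℕ, pdz i (X l : CSeries) = if l = i then 1 else 0) ∧
      pdz i (C c : CSeries) = 0 :=
  fun i F G c => ⟨w1_pdz_smul_add i F G c, w1_pdz_mul i F G, fun j => w1_pdz_comm i j F,
    fun l => w1_pdz_X i l, w1_pdz_C i c⟩

end Summit.KontsevichZagierPeriods.KontsevichZagierPeriods.TypeAGenerationLine
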